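import Literature.AlgebraicGeometry.Resolution.ProjHomogeneousIdealSheaf
import Literature.AlgebraicGeometry.Resolution.IdealSheafLemmas
import Literature.AlgebraicGeometry.Resolution.AffineBlowupCartier
import Literature.AlgebraicGeometry.Resolution.ExceptionalDivisorProjectiveBundle
import Literature.AlgebraicGeometry.Resolution.GenericFibreResolutionDatum
import Literature.AlgebraicGeometry.Resolution.Hironaka2005CompletionOrders
import Literature.AlgebraicGeometry.Hironaka2017.Lib.SingPolynomial
import Literature.AlgebraicGeometry.Hironaka2017.PolynomialExtensionChart
import Literature.AlgebraicGeometry.Motives.VarietiesProjectiveSpaceProofs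
import HarnessLib

/-!
# Crux `PatchingRelPerfect` (stmt-ResolutionOfSingularities-16161), chain W5.2 — TargetsF4 §5, E-side target
# `ConeVertexResolvable ℓ`, OFF-VERTEX HALF: the form ideal of a cone has order `≤ 1` off the vertex

[OURS · L1 W5.2 · TargetsF4 §5] plan-1 g7 STEER 06:34:44Z (B) (res-type-003: `coneVertexResolvable_holds`), split with
res-D-pv-021 06:53:37Z («021 takes cone-exc»: the points of the blow-up over the vertex; THIS FILE: the points off the
vertex, which the weight-`ℓ` blow-up of the vertex does not touch). Setting: `κ₀` a field, `F ∈ κ₀[T₀,…,T_m]` a form of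
degree `ℓ` whose form ideal sheaf `(F)~` on `ℙ^m_{κ₀}` has order `≤ 1` at every point, and the CONE `G = F` read in
`κ₀[T₀,…,T_{m+1}]` (`G = rename castSucc F`). The vertex `(0:…:0:1)` is the only point of `ℙ^{m+1}` outside the charts
`D₊(T_k)`, `k ≤ m`; on each of them `(G)~` has order `≤ 1`
(`idealOrder_cone_le_one_of_mem_basicOpen_castSucc`). Ingredients, all chart-free consequences of tree/Mathlib API:

* `comap_chart_formIdeal` — **the form ideal sheaf pulled back to the chart `Spec (κ₀[T]_{T_s})₀ → ℙⁿ` (`Proj.awayι`) is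
  the ideal sheaf of `(H/T_s^d)`**: the chart square under the closed immersion `Proj κ₀[T]/(H) → ℙⁿ` is cartesian
  (`IsOpenImmersion.isPullback`, `Proj.awayι_comp_map`), so the pulled-back kernel is the kernel of
  `Spec ((κ₀[T]_{T_s})₀ → ((κ₀[T]/(H))_{T_s})₀)` (`Scheme.ker_ideal_of_isPullback_of_isOpenImmersion`,
  `ker_specMap_eq_idealSheaf`), i.e. of `(H)_{(T_s)} = (H/T_s^d)` (`ker_awayMap_eq`, `awayIdeal_span_eq`);
* `idealOrder_formIdeal_chart` — orders of `(H)~` on `D₊(T_s)` are orders of `(H(T_s := 1))~` on `Spec κ₀[y₁,…,y_n]`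
  (`ProjectiveSpace.chartAlgEquiv`, `a/T_s^m ↦ a(T_s := 1)`; open immersions and isomorphisms preserve orders,
  `idealOrder_comap_of_isIso_stalkMap`);
* `smooth_rename_castSucc`, `smooth_cyl`, `idealOrder_cyl` — adjoining one variable is `C : R → R[Fin 1]` followed by a
  ring isomorphism, hence SMOOTH, and orders are constant along the cylinder `Spec κ₀[y : Fin (m+1)] → Spec κ₀[y : Fin m]`
  (`Hironaka2017.idealOrder_comap_eq_of_smooth`, Matsumura §22);
* `dehomogenize_castSucc_rename_castSucc` — `G(T_k := 1) = F(T_k := 1)` read in one more variable (`k ≤ m`).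

The standard grading `MvPolynomial.gradedAlgebra` is a LOCAL instance (Mathlib's documented usage, as in
`Motives/VarietiesProjectiveSpaceProofs`). Fact-free; nothing here is a statement of the manuscript under review;
AI-written, AI review is weaker than expert review.

## References
* R. Hartshorne, *Algebraic Geometry* (1977), I Thm. 3.4 (proof), II Prop. 5.9, Prop. 5.11 (b). [Hartshorne1977]
* H. Matsumura, *Commutative Ring Theory* (1986), §22, Cor. to Thm. 22.5. [Matsumura1987]
-/

-- `Summit.<Summit>.<Sub>.Theorems` with `Sub = Summit` (single-conjunct summit, D-0017)
set_option linter.dupNamespace false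

noncomputable section

open CategoryTheory AlgebraicGeometry TopologicalSpace HomogeneousLocalization
open Literature.AlgebraicGeometry.Resolution Literature.AlgebraicGeometry.Motives
open Literature.RingTheory.GradedAlgebra

namespace Summit.ResolutionOfSingularities.ResolutionOfSingularities.Theorems.DepthCone

universe u

attribute [local instance] MvPolynomial.gradedAlgebra ProjBaseChange.algebraBase
  ProjBaseChange.isScalarTower_localization

variable (κ₀ : Type u) [Field κ₀]

/-- The form ideal sheaf `(H)~ ⊂ 𝒪_{ℙⁿ_{κ₀}}` of ONE form `H` of degree `d` (tree `projIdealSheaf` of the homogeneous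
ideal `(H)`, written with a `Fin 1`-family exactly as F4's `formsIdealSheaf`). [cite: Hartshorne1977, II Prop. 5.9] -/
abbrev formIdeal (n d : ℕ) (H : MvPolynomial (Fin (n + 1)) κ₀)
    (hH : H ∈ MvPolynomial.homogeneousSubmodule (Fin (n + 1)) κ₀ d) :
    (Proj (MvPolynomial.homogeneousSubmodule (Fin (n + 1)) κ₀)).IdealSheafData :=
  projIdealSheaf (MvPolynomial.homogeneousSubmodule (Fin (n + 1)) κ₀)
    ⟨Ideal.span (Set.range fun _ : Fin 1 => H),
      isHomogeneous_span_of_forall_mem _ (fun _ : Fin 1 => H) (fun _ => d) fun _ => hH⟩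

/-- The `s`-th chart `Spec (κ₀[T]_{T_s})₀ ⟶ ℙⁿ` (Mathlib `Proj.awayι`). [folklore] -/
abbrev chart (n : ℕ) (s : Fin (n + 1)) :
    Spec (.of (Away (MvPolynomial.homogeneousSubmodule (Fin (n + 1)) κ₀) (MvPolynomial.X s))) ⟶
      Proj (MvPolynomial.homogeneousSubmodule (Fin (n + 1)) κ₀) :=
  Proj.awayι _ (MvPolynomial.X s) (MvPolynomial.isHomogeneous_X κ₀ s) one_pos

/-- **The form ideal sheaf pulled back to the chart `D₊(T_s)` is the ideal sheaf of `(H/T_s^d)`** on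
`Spec (κ₀[T]_{T_s})₀`: the chart square under the closed immersion `Proj κ₀[T]/(H) → ℙⁿ` is cartesian
(`IsOpenImmersion.isPullback` with `Proj.awayι_comp_map`), so the pulled-back kernel ideal sheaf is the kernel of
`Spec` of `(κ₀[T]_{T_s})₀ → ((κ₀[T]/(H))_{T_s})₀`, whose kernel is `(H)_{(T_s)} = (H/T_s^d)` (`ker_awayMap_eq`,
`awayIdeal_span_eq`). [cite: Hartshorne1977, II Prop. 5.11 (b)] -/
theorem comap_chart_formIdeal (n d : ℕ) (H : MvPolynomial (Fin (n + 1)) κ₀)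
    (hH : H ∈ MvPolynomial.homogeneousSubmodule (Fin (n + 1)) κ₀ d) (s : Fin (n + 1)) :
    (formIdeal κ₀ n d H hH).comap (chart κ₀ n s) =
      affineBlowup.idealSheaf (Ideal.span {mk₁ (MvPolynomial.homogeneousSubmodule (Fin (n + 1)) κ₀)
        (MvPolynomial.isHomogeneous_X κ₀ s) d H hH}) := by
  set 𝒜 := MvPolynomial.homogeneousSubmodule (Fin (n + 1)) κ₀ with h𝒜
  set I : HomogeneousIdeal 𝒜 := ⟨Ideal.span (Set.range fun _ : Fin 1 => H),
      isHomogeneous_span_of_forall_mem _ (fun _ : Fin 1 => H) (fun _ => d) fun _ => hH⟩ with hI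
  have hs : (MvPolynomial.X s : MvPolynomial (Fin (n + 1)) κ₀) ∈ 𝒜 1 := MvPolynomial.isHomogeneous_X κ₀ s
  letI : GradedAlgebra 𝒜 := MvPolynomial.gradedAlgebra
  letI : GradedAlgebra (quotGrading 𝒜 I.toIdeal) := quotGrading.gradedAlgebra 𝒜 I
  -- the graded quotient map and its `Proj`
  let q := quotGradedHom 𝒜 I.toIdeal
  have hq := irrelevant_quotGrading_le_map 𝒜 I
  let f := Proj.map q hq
  haveI : IsClosedImmersion f :=
    Literature.AlgebraicGeometry.FundamentalGroup.isClosedImmersion_projMap_of_surjective q hq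
      (quotGradedHom_surjective 𝒜 I.toIdeal)
  -- the chart square is cartesian
  let iU := Proj.awayι (quotGrading 𝒜 I.toIdeal) (q (MvPolynomial.X s)) (q.2 hs) one_pos
  let g := Spec.map (CommRingCat.ofHom (Away.map q (MvPolynomial.X s)))
  have hsq : iU ≫ f = g ≫ chart κ₀ n s := Proj.awayι_comp_map q hq one_pos (MvPolynomial.X s) hs
  have hpb : IsPullback g iU (chart κ₀ n s) f := by
    refine IsOpenImmersion.isPullback g iU (chart κ₀ n s) f hsq ?_
    rw [Proj.opensRange_awayι, Proj.opensRange_awayι, Proj.map_preimage_basicOpen]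
  -- hence the pulled-back kernel ideal sheaf is the kernel of `g`
  have hker : (formIdeal κ₀ n d H hH).comap (chart κ₀ n s) = g.ker := by
    apply Scheme.IdealSheafData.ext
    funext W
    rw [Scheme.IdealSheafData.ideal_comap_of_isOpenImmersion,
      Scheme.ker_ideal_of_isPullback_of_isOpenImmersion f g iU (chart κ₀ n s) hpb W]
    rfl
  rw [hker]
  -- the kernel of `Spec (Away.map q)` is the ideal sheaf of `ker (Away.map q) = (H)_{(T_s)}`
  have hkerq : RingHom.ker q = I.toIdeal := ker_quotGradedHom 𝒜 I.toIdeal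
  have haway : RingHom.ker (Away.map q (MvPolynomial.X s)) =
      Ideal.span {mk₁ 𝒜 hs d H hH} := by
    rw [ker_awayMap_eq 𝒜 hs q, hkerq]
    change awayIdeal 𝒜 hs (Ideal.span (Set.range fun _ : Fin 1 => H)) = _
    rw [awayIdeal_span_eq 𝒜 hs (fun _ : Fin 1 => H) (fun _ => d) fun _ => hH]
    congr 1
    ext a
    simp only [Set.mem_range, Set.mem_singleton_iff, exists_const]
    exact eq_comm
  change (Spec.map (CommRingCat.ofHom (Away.map q (MvPolynomial.X s)))).ker = _
  rw [ker_specMap_eq_idealSheaf, haway]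

/-- The chart isomorphism `Spec κ₀[y₁,…,y_n] ≅ Spec (κ₀[T]_{T_s})₀` (`Spec` of `ProjectiveSpace.chartAlgEquiv`,
`a/T_s^m ↦ a(T_s := 1)`). [cite: Hartshorne1977, I Thm. 3.4 (proof)] -/
abbrev chartSpec (n : ℕ) (s : Fin (n + 1)) :
    Spec (.of (MvPolynomial (Fin n) κ₀)) ⟶
      Spec (.of (Away (MvPolynomial.homogeneousSubmodule (Fin (n + 1)) κ₀) (MvPolynomial.X s))) :=
  Spec.map (ProjectiveSpace.chartAlgEquiv κ₀ s).toRingEquiv.toCommRingCatIso.hom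

/-- **Orders of the form ideal sheaf are read on the affine chart**: for `z ∈ Spec κ₀[y₁,…,y_n]` with image
`y = awayι (Spec e · z) ∈ D₊(T_s)`, `ord_y (H)~ = ord_z (H(T_s := 1))~` (open immersion and isomorphism preserve
orders; `comap_chart_formIdeal`; `e (H/T_s^d) = H(T_s := 1)`, `ProjectiveSpace.ofChartRingHom_mk`).
[cite: Hartshorne1977, II Prop. 5.11 (b)] -/
theorem idealOrder_formIdeal_chart (n d : ℕ) (H : MvPolynomial (Fin (n + 1)) κ₀)
    (hH : H ∈ MvPolynomial.homogeneousSubmodule (Fin (n + 1)) κ₀ d) (s : Fin (n + 1))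
    (z : Spec (.of (MvPolynomial (Fin n) κ₀))) :
    idealOrder (formIdeal κ₀ n d H hH) (chart κ₀ n s (chartSpec κ₀ n s z)) =
      idealOrder (affineBlowup.idealSheaf (Ideal.span {ProjectiveSpace.dehomogenize κ₀ s H})) z := by
  rw [← idealOrder_comap_of_isIso_stalkMap (chart κ₀ n s) (chartSpec κ₀ n s z) (formIdeal κ₀ n d H hH),
    comap_chart_formIdeal, ← idealOrder_comap_of_isIso_stalkMap (chartSpec κ₀ n s) z]
  congr 1
  change (affineBlowup.idealSheaf _).comap (Spec.map (CommRingCat.ofHom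
    (ProjectiveSpace.chartAlgEquiv κ₀ s).toRingEquiv.toRingHom)) = _
  rw [affineBlowup.comap_idealSheaf_specMap, Ideal.map_span, Set.image_singleton]
  congr 3
  exact ProjectiveSpace.ofChartRingHom_mk s d H (by simpa using hH)

/-! ## The cylinder `Spec κ₀[T₀,…,T_m] → Spec κ₀[T₀,…,T_{m-1}]` (adjoining the last variable) is smooth -/

/-- Adjoining one variable on the right: `κ₀[y : Fin m] → κ₀[y : Fin (m+1)]`, `y_i ↦ y_{castSucc i}`, is the composite of
`C : R → R[Fin 1]` (`R = κ₀[Fin m]`) with a ring isomorphism `R[Fin 1] ≅ κ₀[Fin (m+1)]`; in particular it is a smooth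
ring homomorphism. [folklore] -/
theorem smooth_rename_castSucc (m : ℕ) :
    ((MvPolynomial.rename (Fin.castSucc (n := m)) :
      MvPolynomial (Fin m) κ₀ →ₐ[κ₀] MvPolynomial (Fin (m + 1)) κ₀).toRingHom).Smooth := by
  -- the reindexing `Fin 1 ⊕ Fin m ≃ Fin (m + 1)`, `inr i ↦ castSucc i`, `inl 0 ↦ last`
  let ε : Fin 1 ⊕ Fin m ≃ Fin (m + 1) := (Equiv.sumComm (Fin 1) (Fin m)).trans finSumFinEquiv
  have hε : ∀ i : Fin m, ε (Sum.inr i) = Fin.castSucc i := fun i => by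
    simp [ε, finSumFinEquiv_apply_left]; rfl
  let e : MvPolynomial (Fin 1) (MvPolynomial (Fin m) κ₀) ≃ₐ[κ₀] MvPolynomial (Fin (m + 1)) κ₀ :=
    (MvPolynomial.sumAlgEquiv κ₀ (Fin 1) (Fin m)).symm.trans (MvPolynomial.renameEquiv κ₀ ε)
  have hcomp : (MvPolynomial.rename (Fin.castSucc (n := m)) :
        MvPolynomial (Fin m) κ₀ →ₐ[κ₀] MvPolynomial (Fin (m + 1)) κ₀).toRingHom =
      e.toRingEquiv.toRingHom.comp (algebraMap (MvPolynomial (Fin m) κ₀)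
        (MvPolynomial (Fin 1) (MvPolynomial (Fin m) κ₀))) := by
    refine MvPolynomial.ringHom_ext (fun a => ?_) (fun i => ?_)
    · simp [e, MvPolynomial.algebraMap_eq, MvPolynomial.sumAlgEquiv_symm_C_C]
    · simp [e, MvPolynomial.algebraMap_eq, MvPolynomial.sumAlgEquiv_symm_C_X, hε]
  rw [hcomp]
  have hC : Algebra.Smooth (MvPolynomial (Fin m) κ₀) (MvPolynomial (Fin 1) (MvPolynomial (Fin m) κ₀)) :=
    { formallySmooth := inferInstance, finitePresentation := inferInstance }
  exact RingHom.Smooth.comp (RingHom.smooth_algebraMap.mpr hC)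
    (RingHom.Smooth.of_bijective e.toRingEquiv.bijective)

/-- The cylinder projection `Spec κ₀[y : Fin (m+1)] → Spec κ₀[y : Fin m]` (forget the last coordinate). [folklore] -/
abbrev cyl (m : ℕ) : Spec (.of (MvPolynomial (Fin (m + 1)) κ₀)) ⟶ Spec (.of (MvPolynomial (Fin m) κ₀)) :=
  Spec.map (CommRingCat.ofHom (MvPolynomial.rename (Fin.castSucc (n := m)) :
    MvPolynomial (Fin m) κ₀ →ₐ[κ₀] MvPolynomial (Fin (m + 1)) κ₀).toRingHom)

/-- The cylinder projection is smooth. [folklore] -/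
instance smooth_cyl (m : ℕ) : Smooth (cyl κ₀ m) := by
  rw [HasRingHomProperty.Spec_iff (P := @Smooth)]
  exact smooth_rename_castSucc κ₀ m

/-- **Orders are constant along the cylinder**: for an ideal `J ⊆ κ₀[y : Fin m]`, the order of `J · κ₀[y : Fin (m+1)]`
at a point equals the order of `J` at its projection (`idealOrder_comap_eq_of_smooth`, Matsumura §22).
[cite: Matsumura1987, §22 Cor. to Thm. 22.5] -/
theorem idealOrder_cyl (m : ℕ) (J : Ideal (MvPolynomial (Fin m) κ₀)) (z : Spec (.of (MvPolynomial (Fin (m + 1)) κ₀))) :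
    idealOrder (affineBlowup.idealSheaf (J.map (MvPolynomial.rename (Fin.castSucc (n := m)) :
      MvPolynomial (Fin m) κ₀ →ₐ[κ₀] MvPolynomial (Fin (m + 1)) κ₀))) z =
      idealOrder (affineBlowup.idealSheaf J) (cyl κ₀ m z) := by
  have h := Literature.AlgebraicGeometry.Hironaka2017.idealOrder_comap_eq_of_smooth (cyl κ₀ m)
    (affineBlowup.idealSheaf J) z
  rw [affineBlowup.comap_idealSheaf_specMap] at h
  exact h

/-! ## Dehomogenizing a cone -/

/-- `castSucc` commutes with `succAbove`: `castSucc (k.succAbove j) = (castSucc k).succAbove (castSucc j)`. [folklore] -/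
theorem castSucc_succAbove_eq {m : ℕ} (k : Fin (m + 1)) (j : Fin m) :
    Fin.castSucc (k.succAbove j) = (Fin.castSucc k).succAbove (Fin.castSucc j) := by
  rcases lt_or_ge (Fin.castSucc j) k with h | h
  · rw [Fin.succAbove_of_castSucc_lt _ _ h,
      Fin.succAbove_of_castSucc_lt _ _ (by simpa [Fin.lt_def] using h)]
  · rw [Fin.succAbove_of_le_castSucc _ _ h,
      Fin.succAbove_of_le_castSucc _ _ (by simpa [Fin.le_def] using h)]
    ext; simp

/-- **Dehomogenizing the cone at a base variable**: for `G = F(T₀,…,T_m)` read in `κ₀[T₀,…,T_{m+1}]`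
(`G = rename castSucc F`) and `k ≤ m`, `G(T_k := 1) = F(T_k := 1)` read in one more variable:
`dehomogenize (castSucc k) G = rename castSucc (dehomogenize k F)`. [folklore] -/
theorem dehomogenize_castSucc_rename_castSucc {m : ℕ} (k : Fin (m + 1)) (F : MvPolynomial (Fin (m + 1)) κ₀) :
    ProjectiveSpace.dehomogenize κ₀ (Fin.castSucc k) (MvPolynomial.rename Fin.castSucc F) =
      MvPolynomial.rename Fin.castSucc (ProjectiveSpace.dehomogenize κ₀ k F) := by
  have h : ((ProjectiveSpace.dehomogenize κ₀ (Fin.castSucc k)).comp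
        (MvPolynomial.rename (Fin.castSucc (n := m + 1)))) =
      (MvPolynomial.rename (Fin.castSucc (n := m))).comp (ProjectiveSpace.dehomogenize κ₀ k) := by
    refine MvPolynomial.algHom_ext fun j => ?_
    simp only [AlgHom.comp_apply, MvPolynomial.rename_X]
    by_cases hjk : j = k
    · subst hjk
      rw [ProjectiveSpace.dehomogenize_X_self, ProjectiveSpace.dehomogenize_X_self, map_one]
    · obtain ⟨j', rfl⟩ := Fin.exists_succAbove_eq hjk
      rw [ProjectiveSpace.dehomogenize_X_succAbove, MvPolynomial.rename_X, castSucc_succAbove_eq,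
        ProjectiveSpace.dehomogenize_X_succAbove]
  exact congrArg (fun φ : MvPolynomial (Fin (m + 1)) κ₀ →ₐ[κ₀] MvPolynomial (Fin (m + 1)) κ₀ => φ F) h

/-! ## The off-vertex half of `ConeVertexResolvable` -/

/-- **Off the vertex, the form ideal of the cone has order at most one.** Let `F` be a form of degree `ℓ` in
`T₀,…,T_m` whose form ideal sheaf `(F)~` on `ℙ^m_{κ₀}` has order `≤ 1` everywhere, and `G = F` read in
`T₀,…,T_{m+1}`. Then on every chart `D₊(T_k)`, `k ≤ m`, of `ℙ^{m+1}_{κ₀}` (these charts cover the complement of the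
vertex `(0:…:0:1)`) the form ideal sheaf `(G)~` has order `≤ 1`: on `D₊(T_k) ≅ Spec κ₀[y : Fin (m+1)]` it is generated by
`G(T_k := 1) = F(T_k := 1)`, pulled back along the smooth cylinder `Spec κ₀[y : Fin (m+1)] → Spec κ₀[y : Fin m] ≅ D₊(T_k) ⊂ ℙ^m`,
and orders are preserved by smooth morphisms. [cite: Matsumura1987, §22 Cor. to Thm. 22.5]
[cite: Hartshorne1977, II Prop. 5.11 (b)] -/
theorem idealOrder_cone_le_one_of_mem_basicOpen_castSucc (m ℓ : ℕ) (F : MvPolynomial (Fin (m + 1)) κ₀)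
    (hF : F ∈ MvPolynomial.homogeneousSubmodule (Fin (m + 1)) κ₀ ℓ)
    (hreg : ∀ e : Proj (MvPolynomial.homogeneousSubmodule (Fin (m + 1)) κ₀),
      idealOrder (formIdeal κ₀ m ℓ F hF) e ≤ 1)
    (G : MvPolynomial (Fin (m + 1 + 1)) κ₀)
    (hG : G ∈ MvPolynomial.homogeneousSubmodule (Fin (m + 1 + 1)) κ₀ ℓ)
    (hGF : G = MvPolynomial.rename Fin.castSucc F) (k : Fin (m + 1))
    (y : Proj (MvPolynomial.homogeneousSubmodule (Fin (m + 1 + 1)) κ₀))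
    (hy : y ∈ Proj.basicOpen (MvPolynomial.homogeneousSubmodule (Fin (m + 1 + 1)) κ₀)
      (MvPolynomial.X (Fin.castSucc k))) :
    idealOrder (formIdeal κ₀ (m + 1) ℓ G hG) y ≤ 1 := by
  -- `y = chart (chartSpec z)` for a point `z` of `Spec κ₀[y : Fin (m+1)]`
  have hy' : y ∈ Set.range (chart κ₀ (m + 1) (Fin.castSucc k)).base := by
    rw [← Scheme.Hom.coe_opensRange, Proj.opensRange_awayι]; exact hy
  obtain ⟨y₁, rfl⟩ := hy'
  obtain ⟨z, rfl⟩ := (Scheme.homeoOfIso (asIso (chartSpec κ₀ (m + 1) (Fin.castSucc k)))).surjective y₁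
  change idealOrder _ (chart κ₀ (m + 1) (Fin.castSucc k) (chartSpec κ₀ (m + 1) (Fin.castSucc k) z)) ≤ 1
  rw [idealOrder_formIdeal_chart, hGF, dehomogenize_castSucc_rename_castSucc, ← Set.image_singleton,
    ← Ideal.map_span, idealOrder_cyl]
  -- the projected point, read back on `ℙ^m` through its `k`-th chart
  have h := hreg (chart κ₀ m k (chartSpec κ₀ m k (cyl κ₀ m z)))
  rwa [idealOrder_formIdeal_chart] at h

end Summit.ResolutionOfSingularities.ResolutionOfSingularities.Theorems.DepthCone

end
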